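import Mathlib.LinearAlgebra.FiniteDimensional.Defs
import Mathlib.LinearAlgebra.FiniteDimensional.Lemmas
import Mathlib.LinearAlgebra.Dimension.Finrank
import Mathlib.LinearAlgebra.Dimension.Constructions
import Mathlib.Logic.Function.Basic
import Mathlib.Tactic.FinCases
import Summits.HodgeConjecture.HodgeConjecture.Theorems.WeilTypeLadderH2ThetaBiduality
import HarnessLib

/-!
# The (0,1) cell of the ι-window, EXISTENCE side, XXVI (second file): THE EIGHT-POINT LEMMA IN FULL — `H2-EXISTENCE-SIDE-26.md` 4.3 (prover 3 gen 33)

Family `hodge`, b2b cell `hweil`, `Summits/HodgeConjecture/HodgeConjecture/Theorems` (helper of item stmt-HodgeConjecture-2524). New topic, new file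
(the companion `WeilTypeLadderH2ThetaBiduality.lean` holds the arithmetic shadows and the hypercube propagation lemma `hypercube_constant` used here).

THE LEMMA (vector form, any division ring `K`, any `K`-module `V`): let `v i b` (`i : Fin 4`, `b : Bool`) be eight pairwise linearly independent
vectors such that each of the sixteen TRANSVERSAL quadruples `{v 0 (ε 0), v 1 (ε 1), v 2 (ε 2), v 3 (ε 3)}` (`ε : Fin 4 → Bool`) spans a subspace of
dimension `≤ 3`. Then EITHER all eight vectors lie in a subspace of dimension `≤ 3`, OR five of them (an explicit injective list of index–sign pairs)
lie in a subspace of dimension `≤ 2`. Projectively: sixteen coplanar transversal quadruples among eight distinct points force all eight points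
into a plane or five of them onto a line.
ROLE (report §4): in THEOREM VR the eight vectors are the evaluation functionals of the complete `g⁴₁₂ = |K_{C̃} − L|` at the eight points of `C̃` over
a general canonical divisor of `C`; the sixteen lifts of that divisor are coplanar quadruples by hypothesis; the two alternatives produce a `g¹₄`
resp. a `g²₇` on the Brill–Noether general genus-8 curve `C̃` (`ρ = −2`, `−1`) — contradiction —, so the degree-2 class `L` is effective and exactly
four theta-translates contain Beauville's special curve: `V(C′) = {±a, ±a′}`.
PROOF STRUCTURE (as in 4.3): Case A — every transversal triple spans a 3-space: adjacent quadruples share such a triple, hence have equal spans,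
and the 4-cube is connected (`hypercube_constant`); Case B — some transversal triple is collinear: reduce to the index `0` by the cyclic relabelling
`i ↦ i + j`, then the incidence argument (`eight_point_caseB0`). HONEST FRAMING: this file IS the lemma, completely proved; what is NOT kernel-checked
is its application (Riemann–Roch, base points, birationality of the `g⁴₁₂`, Brill–Noether theory). No case of the Hodge conjecture is proved; nothing
here is a rung; 0 unconditional rungs above the floor. Independently corroborated by exhaustive enumeration over `𝔽₃` (kit j131581: 104 615 280
configurations, 0 violations) — not needed for the proof.
-/

set_option linter.dupNamespace false

namespace Summit.HodgeConjecture.HodgeConjecture.WeilTypeLadder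

section H2EightPointLemmaXXVI
open Submodule Module

variable {K V : Type*} [DivisionRing K] [AddCommGroup V] [Module K V]

/-- the triple off `j` lies in the quadruple, for `ε` and for any update of `ε` at `j`. -/
theorem tripleSpan_le_quadSpan_update (v : Fin 4 → Bool → V) (ε : Fin 4 → Bool) (j : Fin 4) (b : Bool) :
    span K (Set.range fun i : {i : Fin 4 // i ≠ j} => v i.1 (ε i.1)) ≤ span K (Set.range fun i => v i ((Function.update ε j b) i)) := by
  apply span_le.mpr
  rintro _ ⟨⟨i, hi⟩, rfl⟩
  apply subset_span
  refine ⟨i, ?_⟩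
  simp [Function.update, hi]

/-- the transversal triple off `j` spans a subspace of the transversal quadruple's span. -/
theorem tripleSpan_le_quadSpan (v : Fin 4 → Bool → V) (ε : Fin 4 → Bool) (j : Fin 4) :
    span K (Set.range fun i : {i : Fin 4 // i ≠ j} => v i.1 (ε i.1)) ≤ span K (Set.range fun i => v i (ε i)) := by
  have := tripleSpan_le_quadSpan_update (K := K) v ε j (ε j)
  simpa using this

/-- CASE A of the eight-point lemma: if every transversal triple spans a 3-space (is 'non-collinear') and every transversal quadruple spans
at most a 3-space, then all sixteen quadruple spans coincide, so all eight points lie in one 3-space. -/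
theorem eight_point_caseA (v : Fin 4 → Bool → V)
    (hq : ∀ ε : Fin 4 → Bool, finrank K (span K (Set.range fun i => v i (ε i))) ≤ 3)
    (ht : ∀ (ε : Fin 4 → Bool) (j : Fin 4), finrank K (span K (Set.range fun i : {i : Fin 4 // i ≠ j} => v i.1 (ε i.1))) = 3)
    (ε₀ : Fin 4 → Bool) : ∀ (i : Fin 4) (b : Bool), v i b ∈ span K (Set.range fun i => v i (ε₀ i)) := by
  -- adjacent quadruples have the same span
  have hadj : ∀ (ε : Fin 4 → Bool) (j : Fin 4) (b : Bool), span K (Set.range fun i => v i (ε i)) = span K (Set.range fun i => v i ((Function.update ε j b) i)) := by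
    intro ε j b
    haveI : FiniteDimensional K (span K (Set.range fun i => v i (ε i))) := FiniteDimensional.span_of_finite K (Set.finite_range _)
    haveI : FiniteDimensional K (span K (Set.range fun i => v i ((Function.update ε j b) i))) :=
      FiniteDimensional.span_of_finite K (Set.finite_range _)
    have h1 : span K (Set.range fun i : {i : Fin 4 // i ≠ j} => v i.1 (ε i.1)) = span K (Set.range fun i => v i (ε i)) :=
      Submodule.eq_of_le_of_finrank_le (tripleSpan_le_quadSpan v ε j) (by rw [ht]; exact hq ε)
    have h2 : span K (Set.range fun i : {i : Fin 4 // i ≠ j} => v i.1 (ε i.1)) = span K (Set.range fun i => v i ((Function.update ε j b) i)) :=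
      Submodule.eq_of_le_of_finrank_le (tripleSpan_le_quadSpan_update v ε j b) (by rw [ht]; exact hq _)
    rw [← h1, ← h2]
  intro i b
  have hconst := hypercube_constant (fun ε => span K (Set.range fun i => v i (ε i))) hadj (Function.update ε₀ i b) ε₀
  rw [← hconst]
  apply subset_span
  exact ⟨i, by simp⟩


/-- two linearly independent vectors inside a finite-dimensional submodule force its rank to be at least two. -/
theorem two_le_finrank_of_mem {x y : V} (hli : LinearIndependent K ![x, y]) (L : Submodule K V) [FiniteDimensional K L]
    (hx : x ∈ L) (hy : y ∈ L) : 2 ≤ finrank K L := by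
  have hspan : span K (Set.range ![x, y]) ≤ L := by
    apply span_le.mpr
    rintro _ ⟨k, rfl⟩
    fin_cases k <;> simp [hx, hy]
  have hcard : finrank K (span K (Set.range ![x, y])) = 2 := by
    rw [finrank_span_eq_card hli]; simp
  calc 2 = finrank K (span K (Set.range ![x, y])) := hcard.symm
    _ ≤ finrank K L := Submodule.finrank_mono hspan

/-- membership of the four selected points in the quadruple span. -/
theorem mem_quadSpan (v : Fin 4 → Bool → V) (ε : Fin 4 → Bool) (i : Fin 4) :
    v i (ε i) ∈ span K (Set.range fun i => v i (ε i)) :=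
  subset_span ⟨i, rfl⟩


/-- membership of a selected point in the quadruple span, with the selected sign given by an equation. -/
theorem mem_quadSpan_of_eq (v : Fin 4 → Bool → V) (ε : Fin 4 → Bool) (i : Fin 4) (b : Bool) (h : ε i = b) :
    v i b ∈ span K (Set.range fun i => v i (ε i)) :=
  h ▸ mem_quadSpan (K := K) v ε i

/-- injectivity of the first five-point list used in Case B (both points of index 0 and one of each other index). -/
theorem five_list_injective_a (e1 e2 e3 : Bool) :
    Function.Injective (![((0 : Fin 4), false), (0, true), (1, e1), (2, e2), (3, e3)] : Fin 5 → Fin 4 × Bool) := by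
  revert e1 e2 e3
  decide

/-- injectivity of the second five-point list used in Case B (both points of the indices 1, 2 and one of index 3). -/
theorem five_list_injective_b :
    Function.Injective (![((1 : Fin 4), false), (1, true), (2, false), (2, true), (3, false)] : Fin 5 → Fin 4 × Bool) := by
  decide

/-- CASE B of the eight-point lemma at the index `0`: the transversal triple `{v 1 (ε 1), v 2 (ε 2), v 3 (ε 3)}` is collinear (spans at most a
2-space). Conclusion: all eight points in a 3-space, or five of them (an explicit injective list) in a 2-space. -/
theorem eight_point_caseB0 (v : Fin 4 → Bool → V)
    (hind : ∀ p q : Fin 4 × Bool, p ≠ q → LinearIndependent K ![v p.1 p.2, v q.1 q.2])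
    (hq : ∀ ε : Fin 4 → Bool, finrank K (span K (Set.range fun i => v i (ε i))) ≤ 3)
    (ε : Fin 4 → Bool) (hcol : finrank K (span K (Set.range fun i : {i : Fin 4 // i ≠ 0} => v i.1 (ε i.1))) ≤ 2) :
    (∃ W : Submodule K V, FiniteDimensional K W ∧ finrank K W ≤ 3 ∧ ∀ i b, v i b ∈ W) ∨
    (∃ L : Submodule K V, FiniteDimensional K L ∧ finrank K L ≤ 2 ∧
      ∃ f : Fin 5 → Fin 4 × Bool, Function.Injective f ∧ ∀ k, v (f k).1 (f k).2 ∈ L) := by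
  classical
  -- the line λ and its basic properties
  set lam : Submodule K V := span K (Set.range fun i : {i : Fin 4 // i ≠ 0} => v i.1 (ε i.1)) with hlam
  haveI hlamfd : FiniteDimensional K lam := FiniteDimensional.span_of_finite K (Set.finite_range _)
  have hQ : ∀ n : Fin 4, n ≠ 0 → v n (ε n) ∈ lam := fun n hn => subset_span ⟨⟨n, hn⟩, rfl⟩
  -- any two of Q1, Q2, Q3 span λ
  have hpair : ∀ (M : Submodule K V) (n n' : Fin 4), n ≠ 0 → n' ≠ 0 → n ≠ n' →
      v n (ε n) ∈ M → v n' (ε n') ∈ M → lam ≤ M := by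
    intro M n n' hn hn' hnn' hM hM'
    have hli : LinearIndependent K ![v n (ε n), v n' (ε n')] :=
      hind (n, ε n) (n', ε n') (by intro h; exact hnn' (congrArg Prod.fst h))
    -- the pair spans a 2-space P2 inside λ; λ has finrank ≤ 2, so P2 = λ
    set P2 : Submodule K V := span K (Set.range ![v n (ε n), v n' (ε n')]) with hP2
    have hP2le : P2 ≤ lam := by
      apply span_le.mpr
      rintro _ ⟨k, rfl⟩
      fin_cases k
      · exact hQ n hn
      · exact hQ n' hn'
    have hP2rank : finrank K P2 = 2 := by rw [hP2, finrank_span_eq_card hli]; simp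
    have hP2eq : P2 = lam := Submodule.eq_of_le_of_finrank_le hP2le (by rw [hP2rank]; exact hcol)
    rw [← hP2eq]
    apply span_le.mpr
    rintro _ ⟨k, rfl⟩
    fin_cases k
    · exact hM
    · exact hM'
  -- λ is contained in every quadruple span containing two of the Q's, in particular in every quadruple of the form update (update ε 0 b) m c
  have hlam_le_quad : ∀ (b c : Bool) (m : Fin 4), m ≠ 0 →
      lam ≤ span K (Set.range fun i => v i ((Function.update (Function.update ε 0 b) m c) i)) := by
    intro b c m hm
    -- pick the two indices n, n' ∉ {0, m}
    have hex : ∃ n n' : Fin 4, n ≠ 0 ∧ n' ≠ 0 ∧ n ≠ n' ∧ n ≠ m ∧ n' ≠ m := by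
      fin_cases m
      · exact absurd rfl hm
      · exact ⟨2, 3, by decide, by decide, by decide, by decide, by decide⟩
      · exact ⟨1, 3, by decide, by decide, by decide, by decide, by decide⟩
      · exact ⟨1, 2, by decide, by decide, by decide, by decide, by decide⟩
    obtain ⟨n, n', hn, hn', hnn', hnm, hn'm⟩ := hex
    apply hpair _ n n' hn hn' hnn'
    · exact mem_quadSpan_of_eq (K := K) v (Function.update (Function.update ε 0 b) m c) n _ (by simp [Function.update, hnm, hn])
    · exact mem_quadSpan_of_eq (K := K) v (Function.update (Function.update ε 0 b) m c) n' _ (by simp [Function.update, hn'm, hn'])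
  -- first split: are both points of index 0 on λ?
  by_cases h0 : ∀ b : Bool, v 0 b ∈ lam
  · -- (B3): five points on the line λ
    right
    refine ⟨lam, hlamfd, hcol, ![(0, false), (0, true), (1, ε 1), (2, ε 2), (3, ε 3)], five_list_injective_a _ _ _, ?_⟩
    · intro k
      fin_cases k
      · exact h0 false
      · exact h0 true
      · exact hQ 1 (by decide)
      · exact hQ 2 (by decide)
      · exact hQ 3 (by decide)
  · -- (B1)/(B2): some point P := v 0 b₀ is off λ
    push Not at h0
    obtain ⟨b₀, hb₀⟩ := h0
    set Pi : Submodule K V := span K (Set.range fun i => v i ((Function.update ε 0 b₀) i)) with hPi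
    haveI hPifd : FiniteDimensional K Pi := FiniteDimensional.span_of_finite K (Set.finite_range _)
    have hP_Pi : v 0 b₀ ∈ Pi := by
      exact mem_quadSpan_of_eq (K := K) v (Function.update ε 0 b₀) 0 _ (by simp [Function.update])
    have hQ_Pi : ∀ n : Fin 4, n ≠ 0 → v n (ε n) ∈ Pi := by
      intro n hn
      exact mem_quadSpan_of_eq (K := K) v (Function.update ε 0 b₀) n _ (by simp [Function.update, hn])
    have hlam_Pi : lam ≤ Pi := hpair Pi 1 2 (by decide) (by decide) (by decide) (hQ_Pi 1 (by decide)) (hQ_Pi 2 (by decide))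
    have hlam_lt_Pi : lam < Pi := lt_of_le_of_ne hlam_Pi (fun h => hb₀ (h ▸ hP_Pi))
    have hPi3 : finrank K Pi = 3 := by
      have h1 : finrank K lam < finrank K Pi := Submodule.finrank_lt_finrank_of_lt hlam_lt_Pi
      have h2 : 2 ≤ finrank K lam :=
        two_le_finrank_of_mem (hind (1, ε 1) (2, ε 2) (by intro h; have := congrArg Prod.fst h; simp at this)) lam (hQ 1 (by decide)) (hQ 2 (by decide))
      have h3 := hq (Function.update ε 0 b₀)
      rw [← hPi] at h3
      omega
    -- Π is contained in any submodule containing P b₀ and λ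
    have hPi_le : ∀ (M : Submodule K V), v 0 b₀ ∈ M → lam ≤ M → Pi ≤ M := by
      intro M hP hL
      apply span_le.mpr
      rintro _ ⟨i, rfl⟩
      by_cases hi : i = 0
      · subst hi
        show v 0 (Function.update ε 0 b₀ 0) ∈ M
        simpa [Function.update] using hP
      · have : v i (Function.update ε 0 b₀ i) = v i (ε i) := by simp [Function.update, hi]
        show v i (Function.update ε 0 b₀ i) ∈ M
        rw [this]; exact hL (hQ i hi)
    -- every point of index m ≠ 0 lies in Π
    have hall : ∀ (m : Fin 4), m ≠ 0 → ∀ c : Bool, v m c ∈ Pi := by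
      intro m hm c
      set M : Submodule K V := span K (Set.range fun i => v i ((Function.update (Function.update ε 0 b₀) m c) i)) with hM
      haveI : FiniteDimensional K M := FiniteDimensional.span_of_finite K (Set.finite_range _)
      have hPM : v 0 b₀ ∈ M := by
        exact mem_quadSpan_of_eq (K := K) v (Function.update (Function.update ε 0 b₀) m c) 0 _ (by simp [Function.update, hm.symm])
      have hPiM : Pi ≤ M := hPi_le M hPM (hlam_le_quad b₀ c m hm)
      have hMeq : Pi = M := Submodule.eq_of_le_of_finrank_le hPiM (by rw [hPi3]; exact hq _)
      have hvm : v m c ∈ M := by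
        exact mem_quadSpan_of_eq (K := K) v (Function.update (Function.update ε 0 b₀) m c) m _ (by simp [Function.update])
      rw [hMeq]; exact hvm
    -- second split: are all complementary points of indices ≠ 0 on λ?
    by_cases hc : ∀ m : Fin 4, m ≠ 0 → v m (!ε m) ∈ lam
    · -- then both points of the indices 1, 2, 3 lie on λ: five (indeed six) collinear points
      have hboth : ∀ m : Fin 4, m ≠ 0 → ∀ c : Bool, v m c ∈ lam := by
        intro m hm c
        rcases Bool.eq_false_or_eq_true c with h | h
        · by_cases he : ε m = true
          · rw [h, ← he]; exact hQ m hm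
          · have : (!ε m) = true := by simpa using he
            rw [h, ← this]; exact hc m hm
        · by_cases he : ε m = false
          · rw [h, ← he]; exact hQ m hm
          · have : (!ε m) = false := by simpa using he
            rw [h, ← this]; exact hc m hm
      right
      refine ⟨lam, hlamfd, hcol, ![(1, false), (1, true), (2, false), (2, true), (3, false)], five_list_injective_b, ?_⟩
      · intro k
        fin_cases k
        · exact hboth 1 (by decide) false
        · exact hboth 1 (by decide) true
        · exact hboth 2 (by decide) false
        · exact hboth 2 (by decide) true
        · exact hboth 3 (by decide) false
    · -- some complementary point Qc m is off λ: then the quadruple {P (!b₀), Qc m, Q n, Q n'} forces P (!b₀) ∈ Π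
      push Not at hc
      obtain ⟨m, hm, hcm⟩ := hc
      set M' : Submodule K V := span K (Set.range fun i => v i ((Function.update (Function.update ε 0 (!b₀)) m (!ε m)) i)) with hM'
      haveI : FiniteDimensional K M' := FiniteDimensional.span_of_finite K (Set.finite_range _)
      have hlamM' : lam ≤ M' := hlam_le_quad (!b₀) (!ε m) m hm
      have hQcM' : v m (!ε m) ∈ M' := by
        exact mem_quadSpan_of_eq (K := K) v (Function.update (Function.update ε 0 (!b₀)) m (!ε m)) m _ (by simp [Function.update])
      have hP'M' : v 0 (!b₀) ∈ M' := by
        exact mem_quadSpan_of_eq (K := K) v (Function.update (Function.update ε 0 (!b₀)) m (!ε m)) 0 _ (by simp [Function.update, hm.symm])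
      -- Λ' := λ + K·Qc m has finrank 3 and lies in Π and in M'
      set Lam' : Submodule K V := lam ⊔ (K ∙ v m (!ε m)) with hLam'
      have hLam'Pi : Lam' ≤ Pi := sup_le hlam_Pi ((Submodule.span_singleton_le_iff_mem _ _).mpr (hall m hm _))
      have hLam'M' : Lam' ≤ M' := sup_le hlamM' ((Submodule.span_singleton_le_iff_mem _ _).mpr hQcM')
      haveI : FiniteDimensional K Lam' := Submodule.finiteDimensional_of_le hLam'Pi
      have hlam_lt : lam < Lam' := by
        refine lt_of_le_of_ne le_sup_left (fun h => hcm ?_)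
        rw [h]; exact Submodule.mem_sup_right (Submodule.mem_span_singleton_self _)
      have hLam'3 : 3 ≤ finrank K Lam' := by
        have h1 : finrank K lam < finrank K Lam' := Submodule.finrank_lt_finrank_of_lt hlam_lt
        have h2 : 2 ≤ finrank K lam :=
          two_le_finrank_of_mem (hind (1, ε 1) (2, ε 2) (by intro h; have := congrArg Prod.fst h; simp at this)) lam (hQ 1 (by decide)) (hQ 2 (by decide))
        omega
      have hLam'eqM' : Lam' = M' := Submodule.eq_of_le_of_finrank_le hLam'M' (le_trans (hq _) hLam'3)
      have hLam'eqPi : Lam' = Pi := Submodule.eq_of_le_of_finrank_le hLam'Pi (by rw [hPi3]; exact hLam'3)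
      have hP'Pi : v 0 (!b₀) ∈ Pi := by rw [← hLam'eqPi, hLam'eqM']; exact hP'M'
      left
      refine ⟨Pi, hPifd, by rw [hPi3], ?_⟩
      intro i b
      by_cases hi : i = 0
      · subst hi
        rcases Bool.eq_false_or_eq_true b with h | h
        · by_cases hb : b₀ = true
          · rw [h, ← hb]; exact hP_Pi
          · have : (!b₀) = true := by simpa using hb
            rw [h, ← this]; exact hP'Pi
        · by_cases hb : b₀ = false
          · rw [h, ← hb]; exact hP_Pi
          · have : (!b₀) = false := by simpa using hb
            rw [h, ← this]; exact hP'Pi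
      · exact hall i hi b

/-- THE EIGHT-POINT LEMMA ([XXVI]-ex 4.3), vector form over any division ring: eight pairwise independent vectors `v i b` (`i : Fin 4`, `b : Bool`)
such that each of the sixteen TRANSVERSAL quadruples `{v 0 (ε 0), v 1 (ε 1), v 2 (ε 2), v 3 (ε 3)}` spans at most a 3-space. Then either all eight
vectors lie in a 3-space, or five of them lie in a 2-space. (Projectively: 16 coplanar transversal quadruples among 8 distinct points ⟹ all eight
coplanar or five collinear.) -/
theorem eight_point_lemma (v : Fin 4 → Bool → V)
    (hind : ∀ p q : Fin 4 × Bool, p ≠ q → LinearIndependent K ![v p.1 p.2, v q.1 q.2])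
    (hq : ∀ ε : Fin 4 → Bool, finrank K (span K (Set.range fun i => v i (ε i))) ≤ 3) :
    (∃ W : Submodule K V, FiniteDimensional K W ∧ finrank K W ≤ 3 ∧ ∀ i b, v i b ∈ W) ∨
    (∃ L : Submodule K V, FiniteDimensional K L ∧ finrank K L ≤ 2 ∧
      ∃ f : Fin 5 → Fin 4 × Bool, Function.Injective f ∧ ∀ k, v (f k).1 (f k).2 ∈ L) := by
  classical
  by_cases hA : ∀ (ε : Fin 4 → Bool) (j : Fin 4), finrank K (span K (Set.range fun i : {i : Fin 4 // i ≠ j} => v i.1 (ε i.1))) = 3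
  · -- Case A
    left
    let ε₀ : Fin 4 → Bool := fun _ => false
    haveI : FiniteDimensional K (span K (Set.range fun i => v i (ε₀ i))) := FiniteDimensional.span_of_finite K (Set.finite_range _)
    exact ⟨span K (Set.range fun i => v i (ε₀ i)), inferInstance, hq ε₀, eight_point_caseA v hq hA ε₀⟩
  · -- Case B: some transversal triple (off index j, signs ε) is collinear; reduce to j = 0 by the cyclic relabelling i ↦ i + j
    push Not at hA
    obtain ⟨ε, j, hj⟩ := hA
    have hle3 : finrank K (span K (Set.range fun i : {i : Fin 4 // i ≠ j} => v i.1 (ε i.1))) ≤ 3 := by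
      haveI : FiniteDimensional K (span K (Set.range fun i => v i (ε i))) := FiniteDimensional.span_of_finite K (Set.finite_range _)
      exact le_trans (Submodule.finrank_mono (tripleSpan_le_quadSpan v ε j)) (hq ε)
    have hcol : finrank K (span K (Set.range fun i : {i : Fin 4 // i ≠ j} => v i.1 (ε i.1))) ≤ 2 := by omega
    -- relabelled configuration
    let v' : Fin 4 → Bool → V := fun i b => v (i + j) b
    let ε' : Fin 4 → Bool := fun i => ε (i + j)
    have hind' : ∀ p q : Fin 4 × Bool, p ≠ q → LinearIndependent K ![v' p.1 p.2, v' q.1 q.2] := by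
      intro p q hpq
      apply hind (p.1 + j, p.2) (q.1 + j, q.2)
      intro h
      apply hpq
      have h1 := congrArg Prod.fst h; have h2 := congrArg Prod.snd h
      simp only at h1 h2
      exact Prod.ext (add_right_cancel h1) h2
    have hq' : ∀ η : Fin 4 → Bool, finrank K (span K (Set.range fun i => v' i (η i))) ≤ 3 := by
      intro η
      have hset : (Set.range fun i => v' i (η i)) = Set.range fun i => v i ((fun i' => η (i' - j)) i) := by
        ext x; constructor
        · rintro ⟨i, rfl⟩; exact ⟨i + j, by simp [v']⟩
        · rintro ⟨i, rfl⟩; exact ⟨i - j, by simp [v', sub_add_cancel]⟩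
      have : span K (Set.range fun i => v' i (η i)) = span K (Set.range fun i => v i ((fun i' => η (i' - j)) i)) := by
        show span K _ = span K _; rw [hset]
      rw [this]; exact hq _
    have htriple : span K (Set.range fun i : {i : Fin 4 // i ≠ 0} => v' i.1 (ε' i.1)) = span K (Set.range fun i : {i : Fin 4 // i ≠ j} => v i.1 (ε i.1)) := by
      have hset : (Set.range fun i : {i : Fin 4 // i ≠ 0} => v' i.1 (ε' i.1)) =
          Set.range fun i : {i : Fin 4 // i ≠ j} => v i.1 (ε i.1) := by
        ext x; constructor
        · rintro ⟨⟨i, hi⟩, rfl⟩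
          refine ⟨⟨i + j, fun h => hi ?_⟩, by simp [v', ε']⟩
          have := congrArg (· - j) h; simpa using this
        · rintro ⟨⟨i, hi⟩, rfl⟩
          refine ⟨⟨i - j, fun h => hi ?_⟩, by simp [v', ε', sub_add_cancel]⟩
          have := congrArg (· + j) h; simpa [sub_add_cancel] using this
      show span K _ = span K _; rw [hset]
    have hcol' : finrank K (span K (Set.range fun i : {i : Fin 4 // i ≠ 0} => v' i.1 (ε' i.1))) ≤ 2 := by rw [htriple]; exact hcol
    rcases eight_point_caseB0 v' hind' hq' ε' hcol' with ⟨W, hW, hW3, hmem⟩ | ⟨L, hL, hL2, f, hf, hmem⟩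
    · left
      refine ⟨W, hW, hW3, fun i b => ?_⟩
      have := hmem (i - j) b
      simpa [v', sub_add_cancel] using this
    · right
      refine ⟨L, hL, hL2, fun k => ((f k).1 + j, (f k).2), ?_, fun k => by simpa [v'] using hmem k⟩
      intro a a' h
      apply hf
      have h1 := congrArg Prod.fst h; have h2 := congrArg Prod.snd h
      simp only at h1 h2
      exact Prod.ext (add_right_cancel h1) h2

end H2EightPointLemmaXXVI

end Summit.HodgeConjecture.HodgeConjecture.WeilTypeLadder
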